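import Summits.AtomisticToContinuum.BoseEinsteinCondensation.Theorems.BECConjugateDominationPuffFloorPocketClassicalStability
import Summits.AtomisticToContinuum.BoseEinsteinCondensation.Theorems.BECConjugateDominationPuffFloorNoBindingOfStability
import Summits.AtomisticToContinuum.BoseEinsteinCondensation.Theorems.BECConjugateDominationPuffFloorEulerLagrange
import Summits.AtomisticToContinuum.BoseEinsteinCondensation.Theorems.BECConjugateDominationPuffFloorPuffFeynmanFloor
import Summits.AtomisticToContinuum.BoseEinsteinCondensation.Theorems.BECConjugateDominationPuffFloorPositiveMinimiser
import Summits.AtomisticToContinuum.BoseEinsteinCondensation.Theorems.BECConjugateDominationPuffFloorPositiveMinimiserUnique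
import Literature.MathematicalPhysics.QuantumManyBody.PeriodicBoseGasThm31
import Literature.MathematicalPhysics.QuantumManyBody.PeriodicBoseGasImpurityTranslation

/-!
# `PuffFloor` for solid cores — the line `coupling-slope-pocket` assembled
(crux stmt-AtomisticToContinuum-11785, route `BECConjugateDomination`, lead prover
`prover-line-stmt-AtomisticToContinuum-11785-0`, 2026-08-16)

**Main result** `stub_puffFloorSolidCore`: the crux `Theses.BECConjugateDomination.PuffFloor` with ONE extra
hypothesis, a positive soft core `0 < v 0` — for every smooth-class `v` (repulsive finite range, finite, `C²` as
`ṽ(x) = v(|x|)`, edge condition `‖D²ṽ‖ ≤ Cₑ√ṽ`) with `v(0) > 0` there are `C ≥ 0`, `ρ₀ > 0` such that for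
`0 < ρ < ρ₀`, eventually in `n`, every exact, finite-energy, real, nowhere-vanishing minimiser `Ψ` of the periodic
`(n+1)`-body energy on the torus of side `L = ((n+1)/ρ)^{1/3}` has structure factor
`S_m ≥ |k|/√(|k|² + Cρ)` at every mode `m ≠ 0` (`k = 2πm/L`). The statement is the crux's text with its `let`s inlined
(definitionally equal) and `0 < v 0 →` inserted after the edge condition, so that a planner's restatement of
the smooth class with a positive core is closed by `theorem … : PuffFloor' := stub_puffFloorSolidCore`.

**Proof** = the six landed stubs of the line glued as in the registered skeleton
`Cruxes/PuffFloor/Lines/coupling-slope-pocket.lean`: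
* `stub_pocketClassicalStability` (S1, classical stability of the pocket `v − tW`, `W(r) = r²‖D²ṽ(re₀)‖`) +
  `stub_noBindingOfStability` (S2, Lee 2009 Thm 7) ⇒ `t₀ ⟨Ψ, ∑W^per Ψ⟩ ≤ ⟨Ψ, H(v)Ψ⟩` on every large torus
  (`pairMoment_of_positiveCore`), hence at the minimiser `P ≤ E₀/t₀`;
* `bornEnergyBound` (S3, constant trial state): `E₀^per(n+1,L) ≤ ‖ṽ‖₁(n+1)²/L³ = ‖ṽ‖₁ρ(n+1)`;
* `stub_positiveMinimiser` (S5) + `stub_positiveMinimiserUnique` (S6): the crux's `C¹` minimiser is the `C³`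
  positive one; `stub_eulerLagrange` (S4a): it satisfies `−ΔΨ + V^perΨ = E₀Ψ` pointwise;
* `stub_puffFeynmanFloor` (S4b, Puff–Feynman sum rules, `c₁ = 12`, `c₂ = 2`): `c₁T + c₂P ≤ Θ(n+1) ⇒ S_m ≥ |k|/√(|k|²+Θ)`;
  with `T ≤ E₀`, `Θ = (c₁‖ṽ‖₁ + c₂‖ṽ‖₁/t₀)ρ`.
The coreless members of the class (`v 0 = 0`) are NOT covered: for them the Hellmann–Feynman lever is void
(`H(v) − t∑W^per` is unbounded below ∝ −N²) and no mechanism is on file (registered residual stub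
`stub_corelessPairMoment` of the skeleton). Sources: Puff1965; Stringari1995 §2.3 (20)–(23); Lee2009 Thm 7; LSSY2005 Ch. 2.
-/

noncomputable section

namespace Summit.AtomisticToContinuum.BoseEinsteinCondensation.Theorems

open MeasureTheory Filter
open scoped ENNReal NNReal BigOperators
open Literature.MathematicalPhysics.QuantumManyBody.BoseGas
open Summit.AtomisticToContinuum.BoseEinsteinCondensation.Theses.BECConjugateDomination

namespace PuffFloorSolidCore

section EnergyUpperBound

variable {v : ℝ → ℝ≥0∞}

/-- Measurability of the periodised potential. [folklore] -/
private theorem measurable_periodizedPotential' (hv : Measurable v) (L : ℝ) :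
    Measurable (periodizedPotential v L) := by
  unfold periodizedPotential
  exact Measurable.tsum fun n => hv.comp (measurable_id.sub_const _).norm

/-- `∫_{cell^{n+1}} v^per(xᵢ - xⱼ) dX = (∫_{ℝ³} v(|x|)dx) · L^{3n}` for `i ≠ j` (slice integration in
`xᵢ`, unfolding of the periodisation on the cell). [folklore] -/
theorem lintegral_cellN_periodizedPotential_pair (hv : Measurable v) {L : ℝ} (hL : 0 < L) {n : ℕ}
    {i j : Fin (n + 1)} (hij : i ≠ j) :
    ∫⁻ X in cellN (n + 1) L, periodizedPotential v L (X i - X j) =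
      (∫⁻ x : Space, v ‖x‖) * (ENNReal.ofReal L ^ 3) ^ n := by
  have hH : Measurable fun X : Config (n + 1) => periodizedPotential v L (X i - X j) :=
    (measurable_periodizedPotential' hv L).comp ((measurable_pi_apply i).sub (measurable_pi_apply j))
  have key := lintegral_cellN_lintegral_update (L := L) i hH
  have hinner : ∀ X : Config (n + 1),
      (∫⁻ x in cell L, periodizedPotential v L (Function.update X i x i - Function.update X i x j)) =
        ∫⁻ y : Space, v ‖y‖ := by
    intro X
    simp only [Function.update_self, Function.update_of_ne hij.symm]
    exact lintegral_cell_periodizedPotential_sub hL hv (X j)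
  simp only [hinner] at key
  rw [setLIntegral_const, volume_cellN, pow_succ, ← mul_assoc] at key
  have hV0 : (ENNReal.ofReal L ^ 3) ≠ 0 := pow_ne_zero _ ((ENNReal.ofReal_pos.2 hL).ne')
  have hVt : (ENNReal.ofReal L ^ 3) ≠ ⊤ := ENNReal.pow_ne_top ENNReal.ofReal_ne_top
  have key' : (ENNReal.ofReal L ^ 3) * ((∫⁻ y : Space, v ‖y‖) * (ENNReal.ofReal L ^ 3) ^ n) =
      (ENNReal.ofReal L ^ 3) * ∫⁻ X in cellN (n + 1) L, periodizedPotential v L (X i - X j) := by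
    rw [← key]; ring
  exact ((ENNReal.mul_right_inj hV0 hVt).1 key').symm

/-- **`E₀^per(n+1, L) ≤ ((n+1)²/L³) ∫_{ℝ³} v(|x|)dx`** by the constant trial state `Φ ≡ L^{-3(n+1)/2}`
(zero kinetic energy; each of the `≤ (n+1)²` pair terms costs `L⁻³∫ṽ`). [folklore] -/
theorem periodicGroundStateEnergy_le_const (hv : Measurable v) (n : ℕ) {L : ℝ} (hL : 0 < L) :
    periodicGroundStateEnergy v (n + 1) L ≤
      ENNReal.ofReal (((n : ℝ) + 1) ^ 2 / L ^ 3) * ∫⁻ x : Space, v ‖x‖ := by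
  set A : ℝ := (L ^ 3) ^ (n + 1) with hA
  have hLne : L ≠ 0 := hL.ne'
  have hL3 : 0 < L ^ 3 := by positivity
  have hApos : 0 < A := by positivity
  set c : ℝ := (Real.sqrt A)⁻¹ with hcdef
  have hc : ((‖(c : ℂ)‖₊ : ℝ≥0∞) ^ 2) = ENNReal.ofReal A⁻¹ := by
    rw [← ENNReal.coe_pow, ENNReal.ofReal, ENNReal.coe_inj]
    ext
    rw [NNReal.coe_pow, coe_nnnorm, Complex.norm_real, hcdef, norm_inv,
      Real.norm_of_nonneg (Real.sqrt_nonneg _), inv_pow, Real.sq_sqrt hApos.le,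
      Real.coe_toNNReal _ (by positivity)]
  have hvolA : (ENNReal.ofReal L ^ 3) ^ (n + 1) = ENNReal.ofReal A := by
    rw [hA, ← ENNReal.ofReal_pow hL.le, ← ENNReal.ofReal_pow hL3.le]
  let Φ : PeriodicTrialState (n + 1) L :=
    { ψ := fun _ => (c : ℂ)
      contDiff := contDiff_const
      periodic := fun _ _ _ => rfl
      symm := fun _ _ => rfl
      norm_eq := by
        rw [setLIntegral_const, volume_cellN, hc, hvolA, ← ENNReal.ofReal_mul (inv_nonneg.2 hApos.le),
          inv_mul_cancel₀ hApos.ne', ENNReal.ofReal_one] }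
  refine (periodicGroundStateEnergy_le v Φ).trans ?_
  have hkin : ∀ X : Config (n + 1), kineticDensity (fun _ : Config (n + 1) => (c : ℂ)) X = 0 := by
    intro X
    simp [kineticDensity]
  have hE : periodicEnergy v Φ =
      (∫⁻ X in cellN (n + 1) L, periodicInteraction v L X) * ENNReal.ofReal A⁻¹ := by
    unfold periodicEnergy
    rw [← lintegral_mul_const' _ _ ENNReal.ofReal_ne_top]
    refine lintegral_congr fun X => ?_
    change kineticDensity (fun _ : Config (n + 1) => (c : ℂ)) X +
        periodicInteraction v L X * ((‖(c : ℂ)‖₊ : ℝ≥0∞) ^ 2) = _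
    rw [hkin, zero_add, hc]
  set I : ℝ≥0∞ := ∫⁻ x : Space, v ‖x‖ with hI
  set V : ℝ≥0∞ := ENNReal.ofReal L ^ 3 with hV
  have hpair : ∀ i j : Fin (n + 1), i ≠ j →
      ∫⁻ X in cellN (n + 1) L, periodizedPotential v L (X i - X j) = I * V ^ n :=
    fun i j hij => lintegral_cellN_periodizedPotential_pair hv hL hij
  have hmeas : ∀ i j : Fin (n + 1),
      Measurable fun X : Config (n + 1) => periodizedPotential v L (X i - X j) := fun i j =>
    (measurable_periodizedPotential' hv L).comp ((measurable_pi_apply i).sub (measurable_pi_apply j))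
  have hint : (∫⁻ X in cellN (n + 1) L, periodicInteraction v L X) ≤
      ((n + 1 : ℕ) : ℝ≥0∞) * (((n + 1 : ℕ) : ℝ≥0∞) * (I * V ^ n)) := by
    unfold periodicInteraction
    rw [lintegral_finsetSum _ fun i _ => Finset.measurable_sum _ fun j _ => hmeas i j]
    have hrow : ∀ i : Fin (n + 1),
        (∫⁻ X in cellN (n + 1) L, ∑ j : Fin (n + 1) with i < j, periodizedPotential v L (X i - X j)) ≤
          ((n + 1 : ℕ) : ℝ≥0∞) * (I * V ^ n) := by
      intro i
      rw [lintegral_finsetSum _ fun j _ => hmeas i j]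
      have hterm : ∀ j ∈ (Finset.univ.filter fun j : Fin (n + 1) => i < j),
          (∫⁻ X in cellN (n + 1) L, periodizedPotential v L (X i - X j)) = I * V ^ n := by
        intro j hj
        exact hpair i j (Finset.mem_filter.1 hj).2.ne
      rw [Finset.sum_congr rfl hterm, Finset.sum_const, nsmul_eq_mul]
      gcongr
      exact_mod_cast (Finset.card_filter_le _ _).trans (by simp)
    calc (∑ i : Fin (n + 1), ∫⁻ X in cellN (n + 1) L,
            ∑ j : Fin (n + 1) with i < j, periodizedPotential v L (X i - X j))
        ≤ ∑ _i : Fin (n + 1), ((n + 1 : ℕ) : ℝ≥0∞) * (I * V ^ n) := Finset.sum_le_sum fun i _ => hrow i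
      _ = ((n + 1 : ℕ) : ℝ≥0∞) * (((n + 1 : ℕ) : ℝ≥0∞) * (I * V ^ n)) := by
          rw [Finset.sum_const, nsmul_eq_mul, Finset.card_univ, Fintype.card_fin]
  rw [hE]
  calc (∫⁻ X in cellN (n + 1) L, periodicInteraction v L X) * ENNReal.ofReal A⁻¹
      ≤ ((n + 1 : ℕ) : ℝ≥0∞) * (((n + 1 : ℕ) : ℝ≥0∞) * (I * V ^ n)) * ENNReal.ofReal A⁻¹ :=
        mul_le_mul' hint le_rfl
    _ = (((n + 1 : ℕ) : ℝ≥0∞) * ((n + 1 : ℕ) : ℝ≥0∞) * (V ^ n * ENNReal.ofReal A⁻¹)) * I := by ring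
    _ = ENNReal.ofReal (((n : ℝ) + 1) ^ 2 / L ^ 3) * I := by
        congr 1
        rw [hV, ← ENNReal.ofReal_pow hL.le, ← ENNReal.ofReal_pow hL3.le,
          ← ENNReal.ofReal_mul (by positivity), ← ENNReal.ofReal_natCast,
          ← ENNReal.ofReal_mul (by positivity), ← ENNReal.ofReal_mul (by positivity)]
        congr 1
        rw [hA]
        push_cast
        field_simp
        ring

/-- For a finite smooth potential of finite range, `∫_{ℝ³} v(|x|) dx < ∞`. [folklore] -/
theorem lintegral_lt_top_of_smooth (hv : IsRepulsiveFiniteRange v) (hfin : ∀ r, v r ≠ ⊤)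
    (hC : ContDiff ℝ 2 (fun x : Space => (v ‖x‖).toReal)) : (∫⁻ x : Space, v ‖x‖) < ⊤ := by
  obtain ⟨R₀, hR₀⟩ := hv.2
  set f : Space → ℝ := fun x => (v ‖x‖).toReal with hf
  have hfc : Continuous f := hC.continuous
  have hfs : HasCompactSupport f := by
    refine HasCompactSupport.intro (isCompact_closedBall (0 : Space) R₀) fun x hx => ?_
    have hx' : R₀ < ‖x‖ := by
      rw [Metric.mem_closedBall, dist_zero_right] at hx
      exact lt_of_not_ge hx
    simp [hf, hR₀ _ hx']
  have hint : Integrable f volume := hfc.integrable_of_hasCompactSupport hfs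
  have h0 : ∀ x, 0 ≤ f x := fun x => ENNReal.toReal_nonneg
  calc (∫⁻ x : Space, v ‖x‖) = ∫⁻ x : Space, ‖f x‖ₑ := by
        refine lintegral_congr fun x => ?_
        rw [Real.enorm_eq_ofReal (h0 x)]
        simp only [hf]
        rw [ENNReal.ofReal_toReal (hfin _)]
    _ < ⊤ := hint.2

end EnergyUpperBound

/-- **S3 (formerly `stub_bornEnergyBound`, now PROVED).** For a finite smooth finite-range `v` there is
`C_E ≥ 0` (namely `C_E = ‖ṽ‖₁ = ∫_{ℝ³} v(|x|)dx < ∞`) with `E₀^per(n+1, L) ≤ C_E (n+1)²/L³` for every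
`n` and every `L > 0`: the constant trial state. LSSY2005 Ch. 2 (after (2.8)). -/
theorem bornEnergyBound :
    ∀ v : ℝ → ℝ≥0∞, IsRepulsiveFiniteRange v → (∀ r, v r ≠ ⊤) →
      ContDiff ℝ 2 (fun x : Space => (v ‖x‖).toReal) →
      ∃ C_E : ℝ, 0 ≤ C_E ∧ ∀ n : ℕ, ∀ L : ℝ, 0 < L →
        periodicGroundStateEnergy v (n + 1) L ≤
          ENNReal.ofReal (C_E * (((n + 1 : ℕ) : ℝ)) ^ 2 / L ^ 3) := by
  intro v hv hfin hC2
  have hItop : (∫⁻ x : Space, v ‖x‖) ≠ ⊤ := (lintegral_lt_top_of_smooth hv hfin hC2).ne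
  refine ⟨(∫⁻ x : Space, v ‖x‖).toReal, ENNReal.toReal_nonneg, fun n L hL => ?_⟩
  refine (periodicGroundStateEnergy_le_const hv.1 n hL).trans (le_of_eq ?_)
  rw [← ENNReal.ofReal_toReal hItop, ← ENNReal.ofReal_mul (by positivity), ENNReal.ofReal_toReal hItop]
  congr 1
  push_cast
  ring

/-! ## Small proved helpers for the composition -/

/-- A finite-range potential has a POSITIVE range parameter. [folklore] -/
theorem exists_pos_range {v : ℝ → ℝ≥0∞} (hv : IsRepulsiveFiniteRange v) :
    ∃ R₀ : ℝ, 0 < R₀ ∧ ∀ r, R₀ < r → v r = 0 := by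
  obtain ⟨R, hR⟩ := hv.2
  refine ⟨max R 1, lt_max_of_lt_right one_pos, fun r hr => hR r ?_⟩
  exact lt_of_le_of_lt (le_max_left R 1) hr

/-- `L_{n+1}(ρ) = ((n+1)/ρ)^{1/3} > 0`. [folklore] -/
private theorem sideLength_succ_pos {ρ : ℝ} (hρ : 0 < ρ) (n : ℕ) : 0 < sideLength ρ (n + 1) := by
  unfold sideLength
  apply Real.rpow_pos_of_pos
  positivity

/-- `L_{n+1}(ρ) → ∞`. [folklore] -/
theorem tendsto_sideLength_succ {ρ : ℝ} (hρ : 0 < ρ) :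
    Tendsto (fun n : ℕ => sideLength ρ (n + 1)) atTop atTop := by
  have h : Tendsto (fun N : ℕ => sideLength ρ N) atTop atTop :=
    (tendsto_rpow_atTop (by norm_num : (0 : ℝ) < 1 / 3)).comp
      (tendsto_natCast_atTop_atTop.atTop_div_const hρ)
  exact h.comp (tendsto_add_atTop_nat 1)

/-- At `L = L_{n+1}(ρ)`: `C (n+1)² / L³ = C ρ (n+1)`. [folklore] -/
theorem const_mul_sq_div_sideLength_cube {ρ : ℝ} (hρ : 0 < ρ) (C : ℝ) (n : ℕ) :
    C * ((n + 1 : ℕ) : ℝ) ^ 2 / sideLength ρ (n + 1) ^ 3 = C * ρ * ((n : ℝ) + 1) := by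
  have h := div_sideLength_pow_three hρ (Nat.succ_pos n : 0 < n + 1)
  have hL : sideLength ρ (n + 1) ^ 3 ≠ 0 := ne_of_gt (pow_pos (sideLength_succ_pos hρ n) 3)
  rw [div_eq_iff hL] at h
  rw [div_eq_iff hL]
  push_cast at h ⊢
  calc C * ((n : ℝ) + 1) ^ 2 = C * ((n : ℝ) + 1) * (ρ * sideLength ρ (n + 1) ^ 3) := by
        rw [← h]; ring
    _ = C * ρ * ((n : ℝ) + 1) * sideLength ρ (n + 1) ^ 3 := by ring

/-- `ENNReal` bookkeeping: from `a ≤ ofReal x` and `b ≤ ofReal y` (`x, y, c₁, c₂ ≥ 0`),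
`ofReal c₁ · a + ofReal c₂ · b ≤ ofReal (c₁ x + c₂ y)`. [folklore] -/
theorem weighted_add_le {a b : ℝ≥0∞} {x y c₁ c₂ : ℝ} (hx : 0 ≤ x) (hy : 0 ≤ y)
    (hc₁ : 0 ≤ c₁) (hc₂ : 0 ≤ c₂)
    (ha : a ≤ ENNReal.ofReal x) (hb : b ≤ ENNReal.ofReal y) :
    ENNReal.ofReal c₁ * a + ENNReal.ofReal c₂ * b ≤ ENNReal.ofReal (c₁ * x + c₂ * y) := by
  rw [ENNReal.ofReal_add (by positivity) (by positivity), ENNReal.ofReal_mul hc₁,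
    ENNReal.ofReal_mul hc₂]
  gcongr

/-- `ENNReal` bookkeeping of the slope step: `t·P ≤ E ≤ ofReal c` with `t > 0` gives `P ≤ ofReal (c/t)`.
[folklore] -/
theorem le_ofReal_div_of_mul_le {t c : ℝ} (ht : 0 < t) {P E : ℝ≥0∞}
    (h : ENNReal.ofReal t * P ≤ E) (hE : E ≤ ENNReal.ofReal c) :
    P ≤ ENNReal.ofReal (c / t) := by
  rw [ENNReal.ofReal_div_of_pos ht]
  have ht0 : ENNReal.ofReal t ≠ 0 := by
    rw [ENNReal.ofReal_ne_zero_iff]; exact ht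
  refine (ENNReal.le_div_iff_mul_le (Or.inl ht0) (Or.inl ENNReal.ofReal_ne_top)).2 ?_
  rw [mul_comm]
  exact h.trans hE

/-! ## The slope step: S1 + S2 give `PocketNoBinding` (C⁺) for positive cores -/

/-- **`PocketNoBinding` for positive cores**, from the landed S1 (classical stability at `t = t₁`) and S2
(Lee's theorem): `∃ t₀ L₀, ∀ N, ∀ L ≥ L₀, ∀ Ψ, t₀ ⟨Ψ, ∑W^per Ψ⟩ ≤ ⟨Ψ, H(v) Ψ⟩`. [cite: Lee2009, Thm 7] -/
theorem pairMoment_of_positiveCore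
    (v : ℝ → ℝ≥0∞) (hv : IsRepulsiveFiniteRange v) (hfin : ∀ r, v r ≠ ⊤)
    (hC2 : ContDiff ℝ 2 (fun x : Space => (v ‖x‖).toReal))
    (hedge : ∃ Cₑ : ℝ, ∀ x : Space, ‖iteratedFDeriv ℝ 2 (fun x : Space => (v ‖x‖).toReal) x‖
        ≤ Cₑ * Real.sqrt ((v ‖x‖).toReal))
    (hcore : 0 < v 0) {R₀ : ℝ} (hR₀ : 0 < R₀) (hrange : ∀ r, R₀ < r → v r = 0) :
    ∃ t₀ L₀ : ℝ, 0 < t₀ ∧ 0 < L₀ ∧ ∀ N : ℕ, ∀ L : ℝ, L₀ ≤ L → ∀ Ψ : PeriodicTrialState N L,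
      ENNReal.ofReal t₀ *
          (∫⁻ X in cellN N L,
            periodicInteraction (fun r : ℝ => ENNReal.ofReal (r ^ 2 *
              ‖iteratedFDeriv ℝ 2 (fun x : Space => (v ‖x‖).toReal)
                (r • EuclideanSpace.single (0 : Fin 3) (1 : ℝ))‖)) L X *
              (‖Ψ.ψ X‖₊ : ℝ≥0∞) ^ 2)
        ≤ periodicEnergy v Ψ := by
  obtain ⟨t₁, B, ht₁, _hB, hstab⟩ :=
    stub_pocketClassicalStability v hv hfin hC2 hedge hcore R₀ hR₀ hrange
  exact stub_noBindingOfStability v hv hfin hC2 hedge hcore R₀ hR₀ hrange t₁ (B * t₁ ^ 2) ht₁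
    (fun N X => hstab t₁ ht₁ le_rfl N X)

end PuffFloorSolidCore

open PuffFloorSolidCore

/-- **`PuffFloor` for smooth-class potentials with a positive soft core** (crux stmt-AtomisticToContinuum-11785,
route `BECConjugateDomination`, line `coupling-slope-pocket`): the text of `Theses.BECConjugateDomination.PuffFloor`
(its `let`s inlined, definitionally equal) with the extra hypothesis `0 < v 0`. For `0 < ρ < 1` and eventually in `n` (torus side beyond Lee's `L₀`
and beyond `2R₀`), every exact real nowhere-zero finite-energy minimiser has
`kn m / √(kn m² + Cρ) ≤ S m` for all `m ≠ 0`, with `C = c₁‖ṽ‖₁ + c₂‖ṽ‖₁/t₀` (`c₁, c₂` Puff's numerics,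
`t₀` Lee's coupling). Proof: slope step at the minimiser (`t₀P ≤ E(Ψ) = E₀ ≤ ‖ṽ‖₁ρ(n+1)`), identification
with the `C³` positive minimiser (S5, S6), eigenvalue equation (S4a), Puff–Feynman floor (S4b).
Sources: Puff1965; Stringari1995 §2.3 (20)–(23); Lee2009 Thm 7; LSSY2005 Ch. 2. -/
theorem stub_puffFloorSolidCore :
    ∀ v : ℝ → ℝ≥0∞, IsRepulsiveFiniteRange v → (∀ r, v r ≠ ⊤) →
      ContDiff ℝ 2 (fun x : Space => (v ‖x‖).toReal) →
      (∃ Cₑ : ℝ, ∀ x : Space, ‖iteratedFDeriv ℝ 2 (fun x : Space => (v ‖x‖).toReal) x‖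
          ≤ Cₑ * Real.sqrt ((v ‖x‖).toReal)) →
      0 < v 0 →
      ∃ C : ℝ, 0 ≤ C ∧ ∃ ρ₀ : ℝ, 0 < ρ₀ ∧ ∀ ρ : ℝ, 0 < ρ → ρ < ρ₀ → ∀ᶠ n : ℕ in Filter.atTop,
        ∀ Ψ : PeriodicTrialState (n + 1) (sideLength ρ (n + 1)),
          periodicEnergy v Ψ = periodicGroundStateEnergy v (n + 1) (sideLength ρ (n + 1)) →
          periodicEnergy v Ψ ≠ ⊤ → (∀ X, Ψ.ψ X = (‖Ψ.ψ X‖ : ℂ)) → (∀ X, Ψ.ψ X ≠ 0) →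
          ∀ m : Fin 3 → ℤ, m ≠ 0 →
            ‖(2 * Real.pi / sideLength ρ (n + 1)) • latticeVec 1 m‖ /
                Real.sqrt (‖(2 * Real.pi / sideLength ρ (n + 1)) • latticeVec 1 m‖ ^ 2 + C * ρ) ≤
              ((n : ℝ) + 1)⁻¹ *
                ∫ X in cellN (n + 1) (sideLength ρ (n + 1)),
                  ‖∑ j : Fin (n + 1), cellWave (sideLength ρ (n + 1)) m (X j)‖ ^ 2 * ‖Ψ.ψ X‖ ^ 2 := by
  intro v hv hfin hC2 hedge hcore
  obtain ⟨R₀, hR₀, hrange⟩ := exists_pos_range hv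
  obtain ⟨CE, hCE0, hCE⟩ := bornEnergyBound v hv hfin hC2
  obtain ⟨c₁, c₂, hc₁, hc₂, hPuff⟩ := stub_puffFeynmanFloor
  obtain ⟨t₀, L₀, ht₀, _hL₀, hNB⟩ := pairMoment_of_positiveCore v hv hfin hC2 hedge hcore hR₀ hrange
  refine ⟨c₁ * CE + c₂ * (CE / t₀), by positivity, 1, one_pos, fun ρ hρ _ => ?_⟩
  filter_upwards [(tendsto_sideLength_succ hρ).eventually_ge_atTop L₀,
    (tendsto_sideLength_succ hρ).eventually_gt_atTop (2 * R₀)] with n hn h2R₀ Ψ hmin hfinE hreal hne m hm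
  have hLpos : 0 < sideLength ρ (n + 1) := sideLength_succ_pos hρ n
  -- the C³ positive minimiser and its identification with Ψ
  obtain ⟨Ψ₀, hmin₀, _hfin₀, hC3₀, hreal₀, hne₀⟩ :=
    stub_positiveMinimiser v hv hfin hC2 hedge n (sideLength ρ (n + 1)) hLpos
  have hΨ : Ψ = Ψ₀ :=
    stub_positiveMinimiserUnique v hv.1 n (sideLength ρ (n + 1)) hLpos Ψ Ψ₀ hmin hfinE hreal hne
      hmin₀ hreal₀ hne₀
  have hC3 : ContDiff ℝ 3 Ψ.ψ := by rw [hΨ]; exact hC3₀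
  -- the eigenvalue equation of the exact minimiser
  have hEL := stub_eulerLagrange v hv hfin hC2 R₀ hR₀ hrange n (sideLength ρ (n + 1)) hLpos h2R₀ Ψ hC3
    hmin hfinE
  -- energy, kinetic energy and pair moment are O(ρ N)
  have hE : periodicEnergy v Ψ ≤ ENNReal.ofReal (CE * ρ * ((n : ℝ) + 1)) := by
    rw [hmin, ← const_mul_sq_div_sideLength_cube hρ CE n]
    exact hCE n (sideLength ρ (n + 1)) hLpos
  have hT : (∫⁻ X in cellN (n + 1) (sideLength ρ (n + 1)), kineticDensity Ψ.ψ X)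
      ≤ ENNReal.ofReal (CE * ρ * ((n : ℝ) + 1)) :=
    le_trans (lintegral_mono fun X => le_self_add) hE
  have hP := le_ofReal_div_of_mul_le ht₀ (hNB (n + 1) (sideLength ρ (n + 1)) hn Ψ) hE
  have hring₀ : CE * ρ * ((n : ℝ) + 1) / t₀ = CE / t₀ * ρ * ((n : ℝ) + 1) := by ring
  rw [hring₀] at hP
  have key := weighted_add_le (by positivity) (by positivity) hc₁ hc₂ hT hP
  have hring : c₁ * (CE * ρ * ((n : ℝ) + 1)) + c₂ * (CE / t₀ * ρ * ((n : ℝ) + 1)) =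
      (c₁ * CE + c₂ * (CE / t₀)) * ρ * ((n : ℝ) + 1) := by ring
  rw [hring] at key
  exact hPuff v hv hfin hC2 R₀ hR₀ hrange n (sideLength ρ (n + 1)) hLpos h2R₀ Ψ hC3 hmin hfinE hreal hne
    hEL ((c₁ * CE + c₂ * (CE / t₀)) * ρ) (by positivity) key m hm

end Summit.AtomisticToContinuum.BoseEinsteinCondensation.Theorems

end
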